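import Literature.Topology.FourManifolds.SlideCurvesK2a
import Literature.Topology.FourManifolds.SlideCurvesK2b
import HarnessLib

/-!
# The short stubs stay above the tips in twisted height (constant end rate)

Topic `Literature/Topology/FourManifolds`; fact seat `provefact-IsStrictHandleSlide.isSurgery`
(R. C. Kirby, *The Topology of 4-Manifolds*, LNM 1374 (1989), Ch. I §4, Fig. 4.2; remaining content:
the named fact (S) `Literature.Topology.FourManifolds.FramedLink.IsStrictHandleSlide.slideModel`).
For a band end of constant rate `e ≡ e₀` the common stub of the slid circle and of the finger
just before the lower tip — the parameters `t ≤ t_D` with abscissa `X_l t ∈ [1 - 2κ_D, 1 - κ_D]`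
(the **stub set**) — has strictly decreasing twisted height, hence height `> r_D` (the tip
height) before the tip (`y_gt_rD_of_mem_stubSet`). This is what keeps these stub points, which
cross the cut-off annulus of the planar sweep, in the fixed half planes `{|y| ≥ Y}` of
`exists_planarSweep_fix`. Mechanism (as `RouteMonotone`, backwards from the tip): on the stub set
`X₁ = X_l`, `H₁ = Hh`; `ṙ = -Ẋ_l e₀ ≤ -v_min e₀ < 0` (no `e′` term), `|θ̇| ≤ MΘ MH`,
`|α̇| ≤ cmax Mρ MH e₀ + qmaxc MΘ MH =: Aα`, and `t_D - t ≤ κ_D / v_min`, so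
`|α - π/2| ≤ Aα κ_D / v_min =: s`; the criterion `curveY_deriv_neg_of_nearVertical_abs` gives
`ẏ < 0` under the smallness hypotheses `hs1 : s ≤ 1/2`, `hs2 : 4 cmax s ≤ 1`,
`hs3 : 8 qmaxc MΘ MH s < v_min e₀` (all of the form `κ_D · A ≤ B`, granted by
`PreChoice.toSlideChoice'`).

## References

* R. C. Kirby, *The Topology of 4-Manifolds*, LNM 1374, Springer (1989), Ch. I §4. [Kirby1989]
-/

open scoped Topology ContDiff
open Set Real Filter

noncomputable section

namespace Literature.Topology.FourManifolds

/-- **Upper bound of `twistQ`**: for `0 ≤ r ≤ 2` and `0 < θ ≤ θmax < π`,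
`twistQ c r θ ≤ e^{2|c|} / cos² (θmax/2)`. [folklore] -/
theorem twistQ_le_of {c r θ θmax : ℝ} (hr0 : 0 ≤ r) (hr2 : r ≤ 2) (hθ0 : 0 < θ) (hθ : θ ≤ θmax) (hθmax : θmax < π) :
    twistQ c r θ ≤ exp (|c| * 2) / cos (θmax / 2) ^ 2 := by
  set E := exp (c * r) with hE
  have hEp : 0 < E := exp_pos _
  have hcr : |c * r| ≤ |c| * 2 := by
    rw [abs_mul, abs_of_nonneg hr0]; exact mul_le_mul_of_nonneg_left hr2 (abs_nonneg _)
  have hEle : E ≤ exp (|c| * 2) := exp_le_exp.2 ((le_abs_self _).trans hcr)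
  have hc0 : 0 < cos (θ / 2) := cos_pos_of_mem_Ioo ⟨by linarith, by linarith⟩
  have hcm : 0 < cos (θmax / 2) := cos_pos_of_mem_Ioo ⟨by linarith, by linarith⟩
  have hcos : cos (θmax / 2) ≤ cos (θ / 2) := by
    apply cos_le_cos_of_nonneg_of_le_pi <;> linarith
  have hden_ge : cos (θmax / 2) ^ 2 ≤ cos (θ / 2) ^ 2 + E ^ 2 * sin (θ / 2) ^ 2 := by
    have := pow_le_pow_left₀ hcm.le hcos 2; nlinarith [sq_nonneg (E * sin (θ / 2))]
  rw [twistQ, ← hE]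
  calc E / (cos (θ / 2) ^ 2 + E ^ 2 * sin (θ / 2) ^ 2) ≤ E / cos (θmax / 2) ^ 2 :=
        div_le_div_of_nonneg_left hEp.le (pow_pos hcm 2) hden_ge
    _ ≤ exp (|c| * 2) / cos (θmax / 2) ^ 2 := div_le_div_of_nonneg_right hEle (pow_pos hcm 2).le

/-- `|cos α| ≤ |α - π/2|`. [folklore] -/
theorem abs_cos_le_abs_sub_pi_div_two (α : ℝ) : |cos α| ≤ |α - π / 2| := by
  have : cos α = sin (π / 2 - α) := (sin_pi_div_two_sub α).symm
  rw [this, show π / 2 - α = -(α - π / 2) by ring, sin_neg, abs_neg]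
  exact abs_sin_le_abs

/-- `1 - s²/2 ≤ sin α` when `|α - π/2| ≤ s`. [folklore] -/
theorem one_sub_sq_le_sin {α s : ℝ} (h : |α - π / 2| ≤ s) : 1 - s ^ 2 / 2 ≤ sin α := by
  have : sin α = cos (α - π / 2) := by rw [cos_sub_pi_div_two]
  rw [this]
  have h1 := one_sub_sq_div_two_le_cos (x := α - π / 2)
  have h2 : (α - π / 2) ^ 2 ≤ s ^ 2 := by
    have := abs_nonneg (α - π / 2)
    calc (α - π / 2) ^ 2 = |α - π / 2| ^ 2 := (sq_abs _).symm
      _ ≤ s ^ 2 := pow_le_pow_left₀ this h 2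
  linarith

/-- Smoothness of the twisted angle along a route at a regular parameter. [folklore] -/
theorem RouteHyp.contDiffAt_α {d : K2LiteData} (R : RouteHyp d) {τ : ℝ} (hH : d.H₁ τ ∈ Ioo R.w₁ R.w₂)
    (hθ : R.θ τ ∈ Ioo (-π) π) : ContDiffAt ℝ ∞ R.α τ := by
  have hHn : Ioo R.w₁ R.w₂ ∈ 𝓝 (d.H₁ τ) := Ioo_mem_nhds hH.1 hH.2
  have he : ContDiffAt ℝ ∞ (fun s ↦ R.e (d.H₁ s)) τ := (R.e_smooth.contDiffAt hHn).comp τ d.contDiff_H₁.contDiffAt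
  have hΘ : ContDiffAt ℝ ∞ R.θ τ := by
    have : R.θ = fun s ↦ R.Θ (d.H₁ s) := rfl
    rw [this]; exact (R.Θ_smooth.contDiffAt hHn).comp τ d.contDiff_H₁.contDiffAt
  have hr : ContDiffAt ℝ ∞ R.r τ := by
    have : R.r = fun s ↦ 1 + (1 - d.X₁ s) * R.e (d.H₁ s) := rfl
    rw [this]; exact contDiffAt_const.add ((contDiffAt_const.sub d.contDiff_X₁.contDiffAt).mul he)
  have htw : ContDiffAt ℝ ∞ (fun p : ℝ × ℝ ↦ twistAngle R.c p.1 p.2) (R.r τ, R.θ τ) :=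
    (contDiffOn_twistAngle R.c).contDiffAt ((isOpen_univ.prod isOpen_Ioo).mem_nhds (Set.mk_mem_prod (mem_univ _) hθ))
  have hα' : ContDiffAt ℝ ∞ ((fun p : ℝ × ℝ ↦ twistAngle R.c p.1 p.2) ∘ fun s ↦ (R.r s, R.θ s)) τ :=
    htw.comp τ (hr.prodMk hΘ)
  exact hα'

namespace BandCore

variable {A B : Knot} {avoid : Set (Metric.sphere (0 : EuclideanSpace ℝ (Fin 4)) 1)} {c : BandCore A B avoid}

namespace SlideChoice

variable {e₀ : ℝ} (P : c.SlideChoice (fun _ ↦ e₀)) (he₀ : 0 < e₀)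

/-- The constant rate is smooth. [folklore] -/
theorem he_const (e₀ : ℝ) : ContDiffOn ℝ ∞ (fun _ : ℝ ↦ e₀) (Ioo (10⁻¹ : ℝ) (9 / 10)) := contDiffOn_const

/-- The lower route hypotheses for the constant rate. [folklore] -/
def Rc : RouteHyp P.dl := P.routeHypLo (he_const e₀)

/-- **The stub set**: parameters in the window, up to the tip, with abscissa at least `1 - 2κ_D`. [folklore] -/
def stubSet : Set ℝ := {t | t ∈ Icc (P.dl.b - P.dl.ε) P.dl.tD ∧ 1 - 2 * P.κD ≤ P.dl.Xl t}

/-- `tD_mem_stubSet` (auxiliary). [folklore] -/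
theorem tD_mem_stubSet : P.dl.tD ∈ P.stubSet :=
  ⟨⟨P.dl.tD_mem.1.le, le_rfl⟩, by rw [P.dl.Xl_tD]; show 1 - 2 * P.κD ≤ 1 - P.κD; linarith [P.κD_pos]⟩

variable {P}

/-! ### Local formulas on the stub set -/

/-- `stub_I` (auxiliary). [folklore] -/
theorem stub_I {t : ℝ} (ht : t ∈ P.stubSet) : t ∈ Icc (P.dl.b - P.dl.ε) (P.dl.b - P.dl.ε / 2) :=
  ⟨ht.1.1, ht.1.2.trans P.dl.tD_mem.2.le⟩

/-- `stub_Xl_le` (auxiliary). [folklore] -/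
theorem stub_Xl_le {t : ℝ} (ht : t ∈ P.stubSet) : P.dl.Xl t ≤ P.dl.xD := by
  rw [← P.dl.Xl_tD]
  exact P.dl.Xl_le_Xl ht.1.2 (by linarith [P.dl.tD_mem.2, P.dl.ε_pos])

/-- `stub_Sr` (auxiliary). [folklore] -/
theorem dl_κ₀ (P : c.SlideChoice (fun _ ↦ e₀)) : P.dl.κ₀ = 2⁻¹ := rfl

/-- `stub_lt_Xl` (auxiliary). [folklore] -/
theorem stub_lt_Xl {t : ℝ} (ht : t ∈ P.stubSet) : 1 - P.dl.κ₀ < P.dl.Xl t := by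
  have := ht.2; have := P.κD_le_eighth; rw [dl_κ₀]; linarith

/-- `stub_Sr` (auxiliary). [folklore] -/
theorem stub_Sr {t : ℝ} (ht : t ∈ P.stubSet) : P.dl.Sr (P.dl.Hh t) = P.dl.Xl t - (1 - P.dl.κ₀) := by
  have hρ := P.dl.ρt_eq_of_lt_ρt (h := P.dl.Hh t) (stub_lt_Xl ht)
  have : P.dl.Xl t = P.dl.ρt (P.dl.Hh t) := rfl
  linarith

/-- `stub_Sr_zone` (auxiliary). [folklore] -/
theorem stub_Sr_zone {t : ℝ} (ht : t ∈ P.stubSet) :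
    P.dl.Sr (P.dl.Hh t) ∈ Icc (P.dl.κ₀ - 3 * P.dl.κD) (P.dl.κ₀ + 3 * P.dl.κD) := by
  rw [stub_Sr ht, dl_κ₀]
  have h1 := ht.2; have h2 := stub_Xl_le ht
  have hκ : P.dl.κD = P.κD := rfl
  rw [hκ] at *
  have hx : P.dl.xD = 1 - P.κD := rfl
  rw [hx] at h2
  constructor <;> linarith [P.κD_pos]

/-- On the stub set the speed of the abscissa is at least `v_min`. [folklore] -/
theorem stub_vmin_le {t : ℝ} (ht : t ∈ P.stubSet) : P.dl.vmin ≤ deriv P.dl.Xl t :=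
  P.dl.vmin_le_deriv_Xl (stub_I ht) (stub_Sr_zone ht)

/-- `stub_deriv_Xl_le` (auxiliary). [folklore] -/
theorem stub_deriv_Xl_le {t : ℝ} (ht : t ∈ P.stubSet) : deriv P.dl.Xl t ≤ P.Mρ * c.liteMH := by
  have h := P.dl.deriv_Xl_le P.CT_ge (τ := t) ⟨ht.1.1, by linarith [(stub_I ht).2, P.dl.ε_pos]⟩
  have hM : P.dl.Mρ_of P.CT ≤ P.Mρ := P.Mρ_geₗ
  exact h.trans (mul_le_mul_of_nonneg_right hM c.liteMH_pos.le)

/-- The stub set is "convex up to the tip": between a stub parameter and the tip everything is a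
stub parameter. [folklore] -/
theorem stub_of_le {t t' : ℝ} (ht : t ∈ P.stubSet) (htt' : t ≤ t') (ht' : t' ≤ P.dl.tD) : t' ∈ P.stubSet := by
  refine ⟨⟨ht.1.1.trans htt', ht'⟩, ht.2.trans ?_⟩
  exact P.dl.Xl_le_Xl htt' (by linarith [P.dl.tD_mem.2, P.dl.ε_pos])

/-- The height on the stub set lies in `(hr0, h_D]`. [folklore] -/
theorem stub_Hh_mem {t : ℝ} (ht : t ∈ P.stubSet) : P.dl.Hh t ∈ Ioc P.dl.hr0 P.hD := by
  constructor
  · exact P.dl.hr0_lt_of_lt_ρt (stub_lt_Xl ht)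
  · exact P.dl.Hh_le_Hh ht.1.2 (by linarith [P.dl.tD_mem.2, P.dl.ε_pos])

/-- `stub_Hh_win` (auxiliary). [folklore] -/
theorem stub_Hh_win {t : ℝ} (ht : t ∈ P.stubSet) : P.dl.Hh t ∈ Ioo (P.dl.hr0 - 2 * P.μ) (P.dl.hr1 + P.μ) := by
  have h := stub_Hh_mem ht; have hD := P.hD_mem
  exact ⟨by linarith [h.1, P.μ_pos], by linarith [h.2, hD.2, P.μ_pos]⟩

/-- Below the tip: `X₁ = X_l` and `H₁ = Hh` near every `t < t_D`. [folklore] -/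
theorem X₁_eventuallyEq_Xl {t : ℝ} (ht : t < P.dl.tD) : P.dl.X₁ =ᶠ[𝓝 t] P.dl.Xl := by
  filter_upwards [Iio_mem_nhds ht] with s hs
  exact P.dl.X₁_eq_Xl_of_lt_tD hs

/-- `H₁_eq_Hh_of_le` (auxiliary). [folklore] -/
theorem H₁_eq_Hh_of_le {t : ℝ} (ht : t ≤ P.dl.tD) : P.dl.H₁ t = P.dl.Hh t := by
  have hXg : P.dl.Xg t = P.dl.Xl t := P.dl.Xg_of_le (by linarith [P.dl.tD_mem.2, P.dl.ε_pos])
  have hXl : P.dl.Xl t ≤ P.dl.xD := by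
    rcases eq_or_lt_of_le ht with h | h
    · rw [h, P.dl.Xl_tD]
    · rw [← P.dl.X₁_eq_Xl_of_lt_tD h]; exact (P.dl.X₁_lt_xD_of_lt_tD h).le
  have hS : P.dl.S₂ t = 0 := P.dl.S₂_of_le (by rw [hXg]; have : P.dl.xD = 1 - P.dl.κD := rfl; linarith [P.dl.κD_pos])
  rw [K2LiteData.H₁, hS, P.dl.P_of_Xg_le (by rw [hXg]; exact hXl)]; ring

/-- `H₁_eventuallyEq_Hh` (auxiliary). [folklore] -/
theorem H₁_eventuallyEq_Hh {t : ℝ} (ht : t < P.dl.tD) : P.dl.H₁ =ᶠ[𝓝 t] P.dl.Hh := by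
  filter_upwards [Iio_mem_nhds ht] with s hs
  exact H₁_eq_Hh_of_le hs.le

/-! ### The route quantities on the stub set -/

/-- `stub_r_eq` (auxiliary). [folklore] -/
theorem stub_r_eq {t : ℝ} (ht : t ∈ P.stubSet) : P.Rc.r t = 1 + (1 - P.dl.Xl t) * e₀ := by
  show 1 + (1 - P.dl.X₁ t) * e₀ = _
  rcases eq_or_lt_of_le ht.1.2 with h | h
  · rw [h, RouteHyp.X₁_tD (d := P.dl), P.dl.Xl_tD]
  · rw [P.dl.X₁_eq_Xl_of_lt_tD h]

/-- `stub_r_mem` (auxiliary). [folklore] -/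
theorem stub_r_mem (he₀ : 0 < e₀) {t : ℝ} (ht : t ∈ P.stubSet) : P.Rc.r t ∈ Icc P.rD (1 + 2 * P.κD * e₀) := by
  rw [stub_r_eq ht, rD]
  have h1 := ht.2; have h2 := stub_Xl_le ht
  have hx : P.dl.xD = 1 - P.κD := rfl
  constructor <;> nlinarith [he₀]

/-- `stub_θ_eq` (auxiliary). [folklore] -/
theorem stub_θ_eq {t : ℝ} (ht : t ∈ P.stubSet) : P.Rc.θ t = P.Θlo (P.dl.Hh t) := by
  show P.Θlo (P.dl.H₁ t) = _; rw [H₁_eq_Hh_of_le ht.1.2]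

/-- `stub_θ_mem` (auxiliary). [folklore] -/
theorem stub_θ_mem {t : ℝ} (ht : t ∈ P.stubSet) : P.Rc.θ t ∈ Icc (c.θlow / 2) (π - c.θlow / 2) := by
  rw [stub_θ_eq ht]; exact P.Θlo_mem (stub_Hh_win ht)

/-- `stub_θ_mem_Ioo` (auxiliary). [folklore] -/
theorem stub_θ_mem_Ioo {t : ℝ} (ht : t ∈ P.stubSet) : P.Rc.θ t ∈ Ioo (-π) π := by
  have h := stub_θ_mem ht; have := c.θlow_pos
  exact ⟨by linarith [h.1, pi_pos], by linarith [h.2]⟩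


/-! ### Derivatives below the tip -/

/-- `stub_Hh_Ioo` (auxiliary). [folklore] -/
theorem stub_Hh_Ioo {t : ℝ} (ht : t ∈ P.stubSet) : P.dl.Hh t ∈ Ioo (10⁻¹ : ℝ) (9 / 10) :=
  P.winLo_sub' (stub_Hh_win ht)

/-- `stub_hasDerivAt_r` (auxiliary). [folklore] -/
theorem stub_hasDerivAt_r {t : ℝ} (ht : t < P.dl.tD) : HasDerivAt P.Rc.r (-(deriv P.dl.Xl t) * e₀) t := by
  have hX : HasDerivAt P.dl.X₁ (deriv P.dl.Xl t) t :=
    (P.dl.hasDerivAt_Xl t).differentiableAt.hasDerivAt.congr_of_eventuallyEq (X₁_eventuallyEq_Xl ht)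
  have : P.Rc.r = fun s ↦ 1 + (1 - P.dl.X₁ s) * e₀ := rfl
  rw [this, show -(deriv P.dl.Xl t) * e₀ = (0 - deriv P.dl.Xl t) * e₀ by ring]
  exact (((hasDerivAt_const t (1:ℝ)).sub hX).mul_const e₀).const_add 1

/-- `stub_hasDerivAt_θ` (auxiliary). [folklore] -/
theorem stub_hasDerivAt_θ {t : ℝ} (ht : t ∈ P.stubSet) (ht' : t < P.dl.tD) :
    HasDerivAt P.Rc.θ (deriv c.ΘB (P.dl.Hh t) * deriv P.dl.Hh t) t := by
  have hH : HasDerivAt P.dl.H₁ (deriv P.dl.Hh t) t :=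
    (P.dl.contDiff_Hh.differentiable (by simp) t).hasDerivAt.congr_of_eventuallyEq (H₁_eventuallyEq_Hh ht')
  have hΘ : HasDerivAt c.ΘB (deriv c.ΘB (P.dl.Hh t)) (P.dl.H₁ t) := by
    rw [H₁_eq_Hh_of_le ht'.le]; exact c.hasDerivAt_ΘB (stub_Hh_Ioo ht)
  have : P.Rc.θ = fun s ↦ c.ΘB (P.dl.H₁ s) - P.φ := rfl
  rw [this]; exact (hΘ.comp t hH).sub_const _

/-- `stub_hasDerivAt_y` (auxiliary). [folklore] -/
theorem stub_hasDerivAt_y {t : ℝ} (ht : t ∈ P.stubSet) (ht' : t < P.dl.tD) :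
    HasDerivAt P.Rc.y (-(deriv P.dl.Xl t) * e₀ * sin (P.Rc.α t) +
      P.Rc.r t * (cos (P.Rc.α t) * (P.tw * sin (P.Rc.α t) * (-(deriv P.dl.Xl t) * e₀) +
        twistQ P.tw (P.Rc.r t) (P.Rc.θ t) * (deriv c.ΘB (P.dl.Hh t) * deriv P.dl.Hh t)))) t :=
  hasDerivAt_curveY P.tw (stub_hasDerivAt_r ht') (stub_hasDerivAt_θ ht ht') (stub_θ_mem_Ioo ht)

/-- `stub_hasDerivAt_α` (auxiliary). [folklore] -/
theorem stub_hasDerivAt_α {t : ℝ} (ht : t ∈ P.stubSet) (ht' : t < P.dl.tD) :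
    HasDerivAt P.Rc.α (P.tw * sin (P.Rc.α t) * (-(deriv P.dl.Xl t) * e₀) +
      twistQ P.tw (P.Rc.r t) (P.Rc.θ t) * (deriv c.ΘB (P.dl.Hh t) * deriv P.dl.Hh t)) t :=
  hasDerivAt_twistAngle_curve P.tw (stub_hasDerivAt_r ht') (stub_hasDerivAt_θ ht ht') (stub_θ_mem_Ioo ht)

/-! ### Bounds on the stub set -/

/-- The bound `Aα = cmax (Mρ MH e₀) + qmaxc MΘ MH` of `|α̇|`. [folklore] -/
def Aα : ℝ := c.cmax * (P.Mρ * c.liteMH * e₀) + c.qmaxc * P.MΘ * c.liteMH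

/-- The bound `s = Aα κ_D / v_min` of `|α - π/2|` on the stub set. [folklore] -/
def sα : ℝ := P.Aα * P.κD / c.liteVmin2 P.μ_pos

/-- `Aα_nonneg` (auxiliary). [folklore] -/
theorem Aα_nonneg (he₀ : 0 ≤ e₀) : 0 ≤ P.Aα := by
  unfold Aα
  have := c.cmax_nonneg; have := P.Mρ_pos; have := c.liteMH_pos; have := c.qmaxc_pos; have := P.MΘ_pos
  positivity

/-- `sα_nonneg` (auxiliary). [folklore] -/
theorem sα_nonneg (he₀ : 0 ≤ e₀) : 0 ≤ P.sα := by
  unfold sα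
  have := P.Aα_nonneg he₀; have := (c.liteVmin2_spec P.μ_pos).1; have := P.κD_pos
  positivity

/-- `stub_q_le` (auxiliary). [folklore] -/
theorem stub_q_le {t : ℝ} (he₀ : 0 < e₀) (hκ2 : 2 * P.κD * e₀ ≤ 1) (ht : t ∈ P.stubSet) :
    twistQ P.tw (P.Rc.r t) (P.Rc.θ t) ≤ c.qmaxc := by
  have hr := stub_r_mem he₀ ht; have hθ := stub_θ_mem ht; have h1 := P.rD_mem.1
  have h := twistQ_le_of (c := P.tw) (r := P.Rc.r t) (θ := P.Rc.θ t) (θmax := π - c.θlow / 2)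
    (by linarith [hr.1]) (by linarith [hr.2]) (by linarith [hθ.1, c.θlow_pos]) hθ.2 (by linarith [c.θlow_pos])
  exact h.trans P.qmax_le

/-- `stub_θ'_abs_le` (auxiliary). [folklore] -/
theorem stub_θ'_abs_le {t : ℝ} (ht : t ∈ P.stubSet) : |deriv c.ΘB (P.dl.Hh t) * deriv P.dl.Hh t| ≤ P.MΘ * c.liteMH := by
  have hΘ := P.Θ_deriv _ (P.winLo_sub (stub_Hh_win ht))
  have hH0 : 0 < deriv P.dl.Hh t := P.dl.deriv_Hh_pos (by linarith [(stub_I ht).2, P.dl.ε_pos])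
  have hH1 : deriv P.dl.Hh t ≤ c.liteMH := P.dl.deriv_Hh_le_MH ⟨ht.1.1, by linarith [(stub_I ht).2, P.dl.ε_pos]⟩
  rw [abs_mul, abs_of_pos hH0]
  have hM := P.MΘ_pos
  have : |deriv c.ΘB (P.dl.Hh t)| ≤ P.MΘ := abs_le.2 ⟨hΘ.1, by linarith [hΘ.2, P.mΘ_pos]⟩
  exact mul_le_mul this hH1 hH0.le hM.le

/-- `stub_r'_abs_le` (auxiliary). [folklore] -/
theorem stub_r'_abs_le {t : ℝ} (he₀ : 0 < e₀) (ht : t ∈ P.stubSet) : |-(deriv P.dl.Xl t) * e₀| ≤ P.Mρ * c.liteMH * e₀ := by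
  have h0 : 0 ≤ deriv P.dl.Xl t := (c.liteVmin2_spec P.μ_pos).1.le.trans (stub_vmin_le ht)
  rw [neg_mul, abs_neg, abs_of_nonneg (mul_nonneg h0 he₀.le)]
  exact mul_le_mul_of_nonneg_right (stub_deriv_Xl_le ht) he₀.le

/-- `|α̇| ≤ Aα` on the open stub set. [folklore] -/
theorem stub_deriv_α_abs_le {t : ℝ} (he₀ : 0 < e₀) (hκ2 : 2 * P.κD * e₀ ≤ 1) (ht : t ∈ P.stubSet) (ht' : t < P.dl.tD) :
    |deriv P.Rc.α t| ≤ P.Aα := by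
  rw [(stub_hasDerivAt_α ht ht').deriv, Aα]
  have h1 := stub_r'_abs_le he₀ ht; have h2 := stub_θ'_abs_le ht; have h3 := stub_q_le he₀ hκ2 ht
  have hq0 : 0 ≤ twistQ P.tw (P.Rc.r t) (P.Rc.θ t) := (twistQ_pos _ _ (stub_θ_mem_Ioo ht)).le
  have hc := P.abs_tw_le
  calc |P.tw * sin (P.Rc.α t) * (-(deriv P.dl.Xl t) * e₀) + twistQ P.tw (P.Rc.r t) (P.Rc.θ t) * (deriv c.ΘB (P.dl.Hh t) * deriv P.dl.Hh t)|
      ≤ |P.tw * sin (P.Rc.α t) * (-(deriv P.dl.Xl t) * e₀)| + |twistQ P.tw (P.Rc.r t) (P.Rc.θ t) * (deriv c.ΘB (P.dl.Hh t) * deriv P.dl.Hh t)| :=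
        abs_add_le _ _
    _ ≤ c.cmax * (P.Mρ * c.liteMH * e₀) + c.qmaxc * (P.MΘ * c.liteMH) := by
        refine add_le_add ?_ ?_
        · rw [abs_mul, abs_mul]
          have hs : |sin (P.Rc.α t)| ≤ 1 := abs_sin_le_one _
          calc |P.tw| * |sin (P.Rc.α t)| * |-(deriv P.dl.Xl t) * e₀| ≤ c.cmax * 1 * (P.Mρ * c.liteMH * e₀) :=
                mul_le_mul (mul_le_mul hc hs (abs_nonneg _) c.cmax_nonneg) h1 (abs_nonneg _) (by have := c.cmax_nonneg; positivity)
            _ = c.cmax * (P.Mρ * c.liteMH * e₀) := by ring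
        · rw [abs_mul, abs_of_nonneg hq0]
          exact mul_le_mul h3 h2 (abs_nonneg _) c.qmaxc_pos.le
    _ = c.cmax * (P.Mρ * c.liteMH * e₀) + c.qmaxc * P.MΘ * c.liteMH := by ring

/-- The time to the tip is at most `κ_D / v_min`. [folklore] -/
theorem stub_tD_sub_le {t : ℝ} (ht : t ∈ P.stubSet) : P.dl.tD - t ≤ P.κD / c.liteVmin2 P.μ_pos := by
  have hv := (c.liteVmin2_spec P.μ_pos).1
  rcases eq_or_lt_of_le ht.1.2 with h | h
  · rw [h, sub_self]; exact div_nonneg P.κD_pos.le hv.le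
  obtain ⟨ξ, hξ, hslope⟩ := exists_hasDerivAt_eq_slope P.dl.Xl (deriv P.dl.Xl) h
    (P.dl.contDiff_Xl.continuous.continuousOn) (fun s _ ↦ (P.dl.hasDerivAt_Xl s).differentiableAt.hasDerivAt)
  have hξs : ξ ∈ P.stubSet := stub_of_le ht hξ.1.le hξ.2.le
  have hv' : c.liteVmin2 P.μ_pos ≤ deriv P.dl.Xl ξ := stub_vmin_le hξs
  have hdiff : P.dl.Xl P.dl.tD - P.dl.Xl t ≤ P.κD := by
    rw [P.dl.Xl_tD]; have := ht.2; show (1 - P.κD) - P.dl.Xl t ≤ P.κD; linarith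
  rw [le_div_iff₀ hv]
  have hpos : 0 < P.dl.tD - t := by linarith
  have : deriv P.dl.Xl ξ * (P.dl.tD - t) = P.dl.Xl P.dl.tD - P.dl.Xl t := by rw [hslope]; field_simp
  nlinarith

/-- **`|α - π/2| ≤ s` on the stub set.** [folklore] -/
theorem stub_abs_α_sub_le {t : ℝ} (he₀ : 0 < e₀) (hκ2 : 2 * P.κD * e₀ ≤ 1) (ht : t ∈ P.stubSet) : |P.Rc.α t - π / 2| ≤ P.sα := by
  have hv := (c.liteVmin2_spec P.μ_pos).1
  have hA0 : 0 ≤ P.Aα := P.Aα_nonneg he₀.le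
  rcases eq_or_lt_of_le ht.1.2 with h | h
  · rw [h, show P.Rc.α P.dl.tD = π / 2 from P.Rc.α_tD, sub_self, abs_zero]; exact P.sα_nonneg he₀.le
  -- mean value theorem for `α` on `[t, t_D]`
  have hwin : ∀ s ∈ Icc t P.dl.tD, P.dl.H₁ s ∈ Ioo P.Rc.w₁ P.Rc.w₂ := fun s hs ↦ by
    have hs' : s ∈ P.stubSet := stub_of_le ht hs.1 hs.2
    show P.dl.H₁ s ∈ Ioo (P.dl.hr0 - 2 * P.μ) (P.dl.hr1 + P.μ)
    rw [H₁_eq_Hh_of_le hs.2]; exact stub_Hh_win hs'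
  have hcont : ContinuousOn P.Rc.α (Icc t P.dl.tD) := fun s hs ↦
    (P.Rc.contDiffAt_α (hwin s hs) (stub_θ_mem_Ioo (stub_of_le ht hs.1 hs.2))).continuousAt.continuousWithinAt
  have hdiff : ∀ s ∈ Ioo t P.dl.tD, HasDerivAt P.Rc.α (deriv P.Rc.α s) s := fun s hs ↦
    (stub_hasDerivAt_α (stub_of_le ht hs.1.le hs.2.le) hs.2).differentiableAt.hasDerivAt
  obtain ⟨ξ, hξ, hslope⟩ := exists_hasDerivAt_eq_slope P.Rc.α (deriv P.Rc.α) h hcont hdiff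
  have hξs : ξ ∈ P.stubSet := stub_of_le ht hξ.1.le hξ.2.le
  have hb := stub_deriv_α_abs_le he₀ hκ2 hξs hξ.2
  have htime := stub_tD_sub_le ht
  have hpos : 0 < P.dl.tD - t := by linarith
  have heq : P.Rc.α t - π / 2 = -(deriv P.Rc.α ξ * (P.dl.tD - t)) := by
    rw [hslope, show P.Rc.α P.dl.tD = π / 2 from P.Rc.α_tD]; field_simp; ring
  rw [heq, abs_neg, abs_mul, abs_of_pos hpos, sα]
  calc |deriv P.Rc.α ξ| * (P.dl.tD - t) ≤ P.Aα * (P.κD / c.liteVmin2 P.μ_pos) :=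
        mul_le_mul hb htime hpos.le hA0
    _ = P.Aα * P.κD / c.liteVmin2 P.μ_pos := by ring

/-! ### The height decreases on the stub set -/

/-- **`ẏ < 0` below the tip on the stub set**, under the three smallness hypotheses. [cite: Kirby1989, Ch. I §4] -/
theorem stub_deriv_y_neg (he₀ : 0 < e₀) (hκ2 : 2 * P.κD * e₀ ≤ 1) (hs1 : P.sα ≤ 2⁻¹) (hs2 : 4 * c.cmax * P.sα ≤ 1)
    (hs3 : 8 * c.qmaxc * P.MΘ * c.liteMH * P.sα < c.liteVmin2 P.μ_pos * e₀)
    {t : ℝ} (ht : t ∈ P.stubSet) (ht' : t < P.dl.tD) : deriv P.Rc.y t < 0 := by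
  rw [(stub_hasDerivAt_y ht ht').deriv]
  have hv := (c.liteVmin2_spec P.μ_pos).1
  have hr := stub_r_mem he₀ ht
  have hR : 0 < P.Rc.r t := by linarith [hr.1, P.rD_mem.1]
  have hX := stub_vmin_le ht
  have hvd : P.dl.vmin = c.liteVmin2 P.μ_pos := rfl
  rw [hvd] at hX
  have hr' : -(deriv P.dl.Xl t) * e₀ < 0 := by nlinarith
  have hα := stub_abs_α_sub_le he₀ hκ2 ht
  have hcos : |cos (P.Rc.α t)| ≤ P.sα := (abs_cos_le_abs_sub_pi_div_two _).trans hα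
  have hsin : 7 / 8 ≤ sin (P.Rc.α t) := by
    have h := one_sub_sq_le_sin hα
    have : P.sα ^ 2 ≤ 4⁻¹ := by have := P.sα_nonneg he₀.le; nlinarith
    linarith
  have hq0 : 0 ≤ twistQ P.tw (P.Rc.r t) (P.Rc.θ t) := (twistQ_pos _ _ (stub_θ_mem_Ioo ht)).le
  have hq := stub_q_le he₀ hκ2 ht
  have hθ' := stub_θ'_abs_le ht
  apply curveY_deriv_neg_of_nearVertical_abs hR hr' (by linarith) hq0 hcos
  · -- `r |c| s ≤ 1/2`
    have hc := P.abs_tw_le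
    have hr2 : P.Rc.r t ≤ 2 := by linarith [hr.2]
    have hs0 := P.sα_nonneg he₀.le
    calc P.Rc.r t * |P.tw| * P.sα ≤ 2 * c.cmax * P.sα := by
          apply mul_le_mul_of_nonneg_right _ hs0
          exact mul_le_mul hr2 hc (abs_nonneg _) (by norm_num)
      _ ≤ 1 / 2 := by linarith
  · -- the mixing term against the radial decrease
    have hs0 := P.sα_nonneg he₀.le
    have hr2 : P.Rc.r t ≤ 2 := by linarith [hr.2]
    have hlhs : P.Rc.r t * twistQ P.tw (P.Rc.r t) (P.Rc.θ t) * |deriv c.ΘB (P.dl.Hh t) * deriv P.dl.Hh t| * P.sα ≤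
        2 * c.qmaxc * (P.MΘ * c.liteMH) * P.sα := by
      apply mul_le_mul_of_nonneg_right _ hs0
      exact mul_le_mul (mul_le_mul hr2 hq hq0 (by norm_num)) hθ' (abs_nonneg _) (by have := c.qmaxc_pos; positivity)
    have hrhs : c.liteVmin2 P.μ_pos * e₀ * (7 / 8) / 2 ≤ -(-(deriv P.dl.Xl t) * e₀) * sin (P.Rc.α t) / 2 := by
      simp only [neg_mul, neg_neg]
      have : c.liteVmin2 P.μ_pos * e₀ ≤ deriv P.dl.Xl t * e₀ := mul_le_mul_of_nonneg_right hX he₀.le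
      have h78 : 0 ≤ sin (P.Rc.α t) - 7 / 8 := by linarith
      nlinarith [mul_nonneg (mul_nonneg (hv.le.trans hX) he₀.le) h78]
    nlinarith

/-- **The stub stays above the tip**: `y t > r_D` for stub parameters `t < t_D`. [cite: Kirby1989, Ch. I §4] -/
theorem rD_lt_y_of_mem_stubSet (he₀ : 0 < e₀) (hκ2 : 2 * P.κD * e₀ ≤ 1) (hs1 : P.sα ≤ 2⁻¹) (hs2 : 4 * c.cmax * P.sα ≤ 1)
    (hs3 : 8 * c.qmaxc * P.MΘ * c.liteMH * P.sα < c.liteVmin2 P.μ_pos * e₀)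
    {t : ℝ} (ht : t ∈ P.stubSet) (ht' : t < P.dl.tD) : P.rD < P.Rc.y t := by
  have hwin : ∀ s ∈ Icc t P.dl.tD, P.dl.H₁ s ∈ Ioo P.Rc.w₁ P.Rc.w₂ := fun s hs ↦ by
    show P.dl.H₁ s ∈ Ioo (P.dl.hr0 - 2 * P.μ) (P.dl.hr1 + P.μ)
    rw [H₁_eq_Hh_of_le hs.2]; exact stub_Hh_win (stub_of_le ht hs.1 hs.2)
  have hcont : ContinuousOn P.Rc.y (Icc t P.dl.tD) := fun s hs ↦
    (P.Rc.contDiffAt_y (hwin s hs) (stub_θ_mem_Ioo (stub_of_le ht hs.1 hs.2))).continuousAt.continuousWithinAt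
  have hanti : StrictAntiOn P.Rc.y (Icc t P.dl.tD) := by
    refine strictAntiOn_of_deriv_neg (convex_Icc _ _) hcont fun s hs ↦ ?_
    rw [interior_Icc] at hs
    exact stub_deriv_y_neg he₀ hκ2 hs1 hs2 hs3 (stub_of_le ht hs.1.le hs.2.le) hs.2
  have hy : P.Rc.y P.dl.tD = P.rD := by
    rw [P.Rc.y_tD]; rfl
  rw [← hy]
  exact hanti (left_mem_Icc.2 ht'.le) (right_mem_Icc.2 ht'.le) ht'

/-- The weak form, including the tip. [folklore] -/
theorem rD_le_y_of_mem_stubSet (he₀ : 0 < e₀) (hκ2 : 2 * P.κD * e₀ ≤ 1) (hs1 : P.sα ≤ 2⁻¹) (hs2 : 4 * c.cmax * P.sα ≤ 1)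
    (hs3 : 8 * c.qmaxc * P.MΘ * c.liteMH * P.sα < c.liteVmin2 P.μ_pos * e₀)
    {t : ℝ} (ht : t ∈ P.stubSet) : P.rD ≤ P.Rc.y t := by
  rcases eq_or_lt_of_le ht.1.2 with h | h
  · rw [h, P.Rc.y_tD]; exact le_of_eq rfl
  · exact (rD_lt_y_of_mem_stubSet he₀ hκ2 hs1 hs2 hs3 ht h).le

end SlideChoice

end BandCore

end Literature.Topology.FourManifolds
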